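import Literature.NumberTheory.Automorphic.CuspidalContragredientForms
import Literature.NumberTheory.Automorphic.CuspidalContragredientHecke
import Literature.NumberTheory.Automorphic.CuspidalContragredient
import Literature.NumberTheory.Automorphic.AutomorphicTwistSatake
import Literature.NumberTheory.Automorphic.SatakeParamNeZeroProofs
import HarnessLib

/-!
# The contragredient of a cuspidal automorphic representation of `GL_n(𝔸_K)` — the proof

Topic `NumberTheory/Automorphic`. Proofs-only file (theorems, no definitions, no named facts), last
of the series `CuspidalContragredient{Involution, Arch, Forms, Hecke, Proofs}`: it DISCHARGES the
named fact `CuspidalAutomorphicRepData.exists_contragredient_satake` of `CuspidalContragredient`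
(`CuspidalAutomorphicRepData.exists_contragredient_satake_holds`).

For a cuspidal datum `π = W / W'` of `GL_n(𝔸_K)` (`CuspidalAutomorphicRepData n K hcpt`) the
contragredient datum is `π' = (W ∘ τ) / (W' ∘ τ)`, `τ(g) = w₀ ᵗg⁻¹ w₀` — the space of the forms
`g ↦ φ(w₀ ᵗg⁻¹ w₀) = φ̃(w₀ g)`, `φ ∈ W` (Cogdell 2004, §2, before Thm. 2.1; Gelfand–Kazhdan). It is a
cuspidal automorphic representation datum by `CuspidalContragredientForms`, and at every finite
place `v` where `π` has Satake parameter `α` (level `K(𝔫)`, `v ∤ 𝔫`), `π'` has Satake parameter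
`α⁻¹ = {a⁻¹}` at the same level (Getz–Hahn 2024, Prop. 7.6.2: `I(λ)^∨ ≅ I(-λ)`):
`τ(K(𝔫)) = K(𝔫)`, `τ(t_{v,i}) = t_{v,n}⁻¹ t_{v,n-i}`
(`weylLong_mul_glTransposeInv_mul_weylLong_heckeDiagAt`), so on the `K(𝔫)`-fixed eigenform `φ ∘ τ`
the operator `[K(𝔫) t_{v,i} K(𝔫)]` acts as `r(t_{v,n}⁻¹) [K(𝔫) t_{v,n-i} K(𝔫)]` does on `φ`
(`CuspidalContragredientHecke`), i.e. by `e_n(α)⁻¹ q_v^{i(n-i)/2} e_{n-i}(α) = q_v^{i(n-i)/2} e_i(α⁻¹)`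
modulo `W'` (`hasSatakeParamAt_map_funLeft_weylLong_mul_glTransposeInv_mul_weylLong`, stated on the
unfolded form of `AutomorphicRepData.HasSatakeParamAt` for a pair `W' ≤ W`).

## References

* J. W. Cogdell, *Analytic theory of L-functions for GL_n*, in: An Introduction to the Langlands
  Program, Birkhäuser 2004, §1 (after Thm. 1.2), §2 (Thm. 2.1). [CogdellAnalyticTheory2004]
* J. R. Getz, H. Hahn, *An Introduction to Automorphic Representations*, GTM 300 (2024),
  Prop. 7.6.2. [GetzHahn2024]
* A. Borel, H. Jacquet, *Automorphic forms and automorphic representations*, PSPM 33.1 (1979),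
  4.6. [BorelJacquetCorvallis1979]
-/

noncomputable section

open scoped MatrixGroups Matrix NNReal Classical ContDiff
open NumberField IsDedekindDomain

namespace Literature.NumberTheory.Automorphic

open GaloisRepresentations (glTransposeInv coe_glTransposeInv_apply)

/-! ### Satake parameters of `W ∘ τ / W' ∘ τ`: `α ↦ α⁻¹` -/

section Satake

variable {n : ℕ} {K : Type} [Field K] [NumberField K] {hcpt : isCompact_glFiniteIntegralLevel n K}

local notation "𝒟" => AutomorphyDatum.gl n K hcpt
local notation "τ𝔸[" g "]" => weylLong n (AdeleRing (𝓞 K) K) *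
  glTransposeInv (Fin n) (AdeleRing (𝓞 K) K) g * weylLong n (AdeleRing (𝓞 K) K)
set_option quotPrecheck false in
local notation "τ𝔸⋆" => LinearMap.funLeft ℂ ℂ (m := (AdelicGroupData.gl n K).Adelic)
  (n := (AdelicGroupData.gl n K).Adelic) fun g => τ𝔸[g]

/-- **`τ` on the Hecke elements**: `τ(t_{v,i}) = t_{v,n}⁻¹ · t_{v,n-i}` for `i ≤ n`
(`τ(diag(ϖ,…,ϖ,1,…,1)) = diag(1,…,1,ϖ⁻¹,…,ϖ⁻¹)`). [folklore] -/
theorem weylLong_mul_glTransposeInv_mul_weylLong_heckeDiagAt (v : HeightOneSpectrum (𝓞 K))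
    (ϖ : (v.adicCompletion K)ˣ) {i : ℕ} (hi : i ≤ n) :
    τ𝔸[heckeDiagAt n K v ϖ i] = (heckeDiagAt n K v ϖ n)⁻¹ * heckeDiagAt n K v ϖ (n - i) := by
  unfold heckeDiagAt
  rw [weylLong_mul_glTransposeInv_mul_weylLong_glDiagonal, ← map_inv, ← map_mul]
  congr 1
  funext k
  rw [Pi.mul_apply, Pi.inv_apply, Fin.val_rev, if_pos k.2]
  by_cases h : (k : ℕ) < n - i
  · rw [if_pos h, if_neg (by omega), inv_one, inv_mul_cancel]
  · rw [if_neg h, if_pos (by omega), mul_one]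

/-- **Hecke operators on `φ ∘ τ`** at a `τ`-stable level `K(𝔫)`: for a `K(𝔫)`-invariant `φ`,
`[K(𝔫) t K(𝔫)] (φ ∘ τ) = ([K(𝔫) τ(t) K(𝔫)] φ) ∘ τ`. [folklore] -/
theorem heckeOperator_funLeft_weylLong_mul_glTransposeInv_mul_weylLong (𝔫 : Ideal (𝓞 K))
    (t : (AdelicGroupData.gl n K).Adelic) {φ : (AdelicGroupData.gl n K).Adelic → ℂ}
    (hφ : ∀ u ∈ principalCongruenceLevel n K 𝔫, rightTranslation (AdelicGroupData.gl n K) u φ = φ) :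
    heckeOperator (rightTranslation (AdelicGroupData.gl n K)) (principalCongruenceLevel n K 𝔫) t (τ𝔸⋆ φ) =
      τ𝔸⋆ (heckeOperator (rightTranslation (AdelicGroupData.gl n K)) (principalCongruenceLevel n K 𝔫)
        (τ𝔸[t]) φ) := by
  let e : (AdelicGroupData.gl n K).Adelic ≃* (AdelicGroupData.gl n K).Adelic :=
    { toFun := fun g => τ𝔸[g]
      invFun := fun g => τ𝔸[g]
      left_inv := weylLong_mul_glTransposeInv_mul_weylLong_involutive
      right_inv := weylLong_mul_glTransposeInv_mul_weylLong_involutive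
      map_mul' := weylLong_mul_glTransposeInv_mul_weylLong_mul }
  have hfix : φ ∈ (rightTranslation (AdelicGroupData.gl n K)).fixedPoints (principalCongruenceLevel n K 𝔫) :=
    (Representation.mem_fixedPoints _ _ _).2 hφ
  exact heckeOperator_apply_of_semiconj_mulEquiv (rightTranslation (AdelicGroupData.gl n K))
    (principalCongruenceLevel n K 𝔫) e
    (fun g => weylLong_mul_glTransposeInv_mul_weylLong_mem_principalCongruenceLevel_iff g) τ𝔸⋆
    (fun y w => rightTranslation_funLeft_weylLong_mul_glTransposeInv_mul_weylLong y w) t hfix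

/-- **Satake parameters of the contragredient datum.** In the vocabulary of
`AutomorphicRepData.HasSatakeParamAt` (unfolded, for a pair of subspaces `W' ≤ W` with `W'` stable):
if some `K(𝔫)`-fixed `φ ∈ W ∖ W'` is a Hecke eigenform modulo `W'` at `v ∤ 𝔫` with the
Satake–Tamagawa eigenvalues of `α` (`#α = n`), then `φ ∘ τ ∈ W ∘ τ ∖ W' ∘ τ` is one with the
eigenvalues of `α⁻¹ = {a⁻¹ : a ∈ α}`: `[K(𝔫) t_{v,i} K(𝔫)] (φ ∘ τ) = ([K(𝔫) t_{v,n}⁻¹ t_{v,n-i} K(𝔫)] φ) ∘ τ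
= (r(t_{v,n}⁻¹) [K(𝔫) t_{v,n-i} K(𝔫)] φ) ∘ τ ≡ e_n(α)⁻¹ q_v^{i(n-i)/2} e_{n-i}(α) (φ ∘ τ)`, and
`e_i(α⁻¹) = e_{n-i}(α) / e_n(α)`. (Getz–Hahn 2024, Prop. 7.6.2: `I(λ)^∨ ≅ I(-λ)`; Cogdell 2004, §2.)
[folklore] -/
theorem hasSatakeParamAt_map_funLeft_weylLong_mul_glTransposeInv_mul_weylLong
    {W W' : Submodule ℂ ((AdelicGroupData.gl n K).Adelic → ℂ)} (hW' : IsStableSubmodule (𝒟) W')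
    {v : HeightOneSpectrum (𝓞 K)} {α : Multiset ℂ}
    (h : ∃ (𝔫 : Ideal (𝓞 K)) (ϖ : (v.adicCompletion K)ˣ), 𝔫 ≠ 0 ∧ ¬ v.asIdeal ∣ 𝔫 ∧
      Valued.v (ϖ : v.adicCompletion K) = WithZero.exp (-1 : ℤ) ∧ Multiset.card α = n ∧
        ∃ φ ∈ W, φ ∉ W' ∧
          (∀ u ∈ principalCongruenceLevel n K 𝔫,
            rightTranslation (AdelicGroupData.gl n K) u φ = φ) ∧
          ∀ i ≤ n, heckeOperator (rightTranslation (AdelicGroupData.gl n K))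
                (principalCongruenceLevel n K 𝔫) (heckeDiagAt n K v ϖ i) φ -
              ((((Real.sqrt (v.residueCard : ℝ)) : ℝ) : ℂ) ^ (i * (n - i)) * α.esymm i) • φ ∈ W') :
    ∃ (𝔫 : Ideal (𝓞 K)) (ϖ : (v.adicCompletion K)ˣ), 𝔫 ≠ 0 ∧ ¬ v.asIdeal ∣ 𝔫 ∧
      Valued.v (ϖ : v.adicCompletion K) = WithZero.exp (-1 : ℤ) ∧ Multiset.card (α.map (·⁻¹)) = n ∧
        ∃ φ ∈ W.map τ𝔸⋆, φ ∉ W'.map τ𝔸⋆ ∧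
          (∀ u ∈ principalCongruenceLevel n K 𝔫,
            rightTranslation (AdelicGroupData.gl n K) u φ = φ) ∧
          ∀ i ≤ n, heckeOperator (rightTranslation (AdelicGroupData.gl n K))
                (principalCongruenceLevel n K 𝔫) (heckeDiagAt n K v ϖ i) φ -
              ((((Real.sqrt (v.residueCard : ℝ)) : ℝ) : ℂ) ^ (i * (n - i)) * (α.map (·⁻¹)).esymm i) • φ ∈
                W'.map τ𝔸⋆ := by
  obtain ⟨𝔫, ϖ, h𝔫, hv, hϖ, hcard, φ, hφW, hφW', hfix, heig⟩ := h
  have hfix' : φ ∈ (rightTranslation (AdelicGroupData.gl n K)).fixedPoints (principalCongruenceLevel n K 𝔫) :=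
    (Representation.mem_fixedPoints _ _ _).2 hfix
  have hcen : heckeDiagAt n K v ϖ n ∈ Subgroup.center (AdelicGroupData.gl n K).Adelic :=
    heckeDiagAt_self_mem_center v ϖ
  have htninv : ((heckeDiagAt n K v ϖ n)⁻¹ : GL (Fin n) (AdeleRing (𝓞 K) K)) ∈ (𝒟).finiteAdelic := by
    rw [AutomorphyDatum.gl_finiteAdelic]
    exact Subgroup.inv_mem _ (heckeDiagAt_mem_range_ofFinite n K v ϖ n)
  -- `r(t_{v,n}) φ ≡ e_n(α) φ`, hence `e_n(α) ≠ 0` and `r(t_{v,n}⁻¹) φ ≡ e_n(α)⁻¹ φ` modulo `W'`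
  have hTn : heckeOperator (rightTranslation (AdelicGroupData.gl n K)) (principalCongruenceLevel n K 𝔫)
      (heckeDiagAt n K v ϖ n) φ = rightTranslation (AdelicGroupData.gl n K) (heckeDiagAt n K v ϖ n) φ :=
    heckeOperator_apply_of_mem_center _ _ hcen hfix'
  have hn := heig n le_rfl
  rw [Nat.sub_self, mul_zero, pow_zero, one_mul, hTn] at hn
  have hRinv : ∀ ψ : (AdelicGroupData.gl n K).Adelic → ℂ,
      rightTranslation (AdelicGroupData.gl n K) ((heckeDiagAt n K v ϖ n)⁻¹ : GL (Fin n) (AdeleRing (𝓞 K) K))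
        (rightTranslation (AdelicGroupData.gl n K) (heckeDiagAt n K v ϖ n) ψ) = ψ := fun ψ => by
    funext g
    simp only [rightTranslation_apply]
    exact congrArg ψ (inv_mul_cancel_right g _)
  have hback : φ - α.esymm n • rightTranslation (AdelicGroupData.gl n K)
      ((heckeDiagAt n K v ϖ n)⁻¹ : GL (Fin n) (AdeleRing (𝓞 K) K)) φ ∈ W' := by
    have := hW'.finite_stable _ htninv hn
    rwa [Submodule.mem_comap, map_sub, map_smul, hRinv] at this
  have hne : α.esymm n ≠ 0 := by
    intro h0
    rw [h0, zero_smul, sub_zero] at hback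
    exact hφW' hback
  have hinv : rightTranslation (AdelicGroupData.gl n K)
      ((heckeDiagAt n K v ϖ n)⁻¹ : GL (Fin n) (AdeleRing (𝓞 K) K)) φ - (α.esymm n)⁻¹ • φ ∈ W' := by
    have := W'.smul_mem (-(α.esymm n)⁻¹) hback
    have hcalc : (-(α.esymm n)⁻¹) • (φ - α.esymm n •
        rightTranslation (AdelicGroupData.gl n K) ((heckeDiagAt n K v ϖ n)⁻¹ : GL (Fin n) (AdeleRing (𝓞 K) K)) φ) =
        rightTranslation (AdelicGroupData.gl n K) ((heckeDiagAt n K v ϖ n)⁻¹ : GL (Fin n) (AdeleRing (𝓞 K) K)) φ -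
          (α.esymm n)⁻¹ • φ := by
      rw [smul_sub, smul_smul, neg_mul, inv_mul_cancel₀ hne, neg_smul, neg_smul, one_smul]
      abel
    rwa [hcalc] at this
  have hnot : τ𝔸⋆ φ ∉ W'.map τ𝔸⋆ := fun h' => hφW' (by
    have := (mem_map_funLeft_weylLong_mul_glTransposeInv_mul_weylLong_iff _ _).1 h'
    rwa [funLeft_weylLong_mul_glTransposeInv_mul_weylLong_involutive] at this)
  refine ⟨𝔫, ϖ, h𝔫, hv, hϖ, by rw [Multiset.card_map, hcard], τ𝔸⋆ φ, Submodule.mem_map_of_mem hφW,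
    hnot, fun u hu => ?_, fun i hi => ?_⟩
  · rw [rightTranslation_funLeft_weylLong_mul_glTransposeInv_mul_weylLong,
      hfix _ (weylLong_mul_glTransposeInv_mul_weylLong_mem_principalCongruenceLevel hu)]
  · -- `[K t_{v,i} K] (φ ∘ τ) = (r(t_{v,n}⁻¹) [K t_{v,n-i} K] φ) ∘ τ`
    have hcm : heckeOperator (rightTranslation (AdelicGroupData.gl n K)) (principalCongruenceLevel n K 𝔫)
        ((heckeDiagAt n K v ϖ n)⁻¹ * heckeDiagAt n K v ϖ (n - i)) φ =
        rightTranslation (AdelicGroupData.gl n K) (heckeDiagAt n K v ϖ n)⁻¹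
          (heckeOperator (rightTranslation (AdelicGroupData.gl n K)) (principalCongruenceLevel n K 𝔫)
            (heckeDiagAt n K v ϖ (n - i)) φ) :=
      heckeOperator_center_mul_apply _ _ (Subgroup.inv_mem _ hcen) _ hfix'
    rw [heckeOperator_funLeft_weylLong_mul_glTransposeInv_mul_weylLong 𝔫 _ hfix,
      weylLong_mul_glTransposeInv_mul_weylLong_heckeDiagAt v ϖ hi, hcm, ← map_smul, ← map_sub]
    refine Submodule.mem_map_of_mem ?_
    have hni := heig (n - i) (Nat.sub_le n i)
    have hcoef := satakeEigenvalue_map_inv (((Real.sqrt (v.residueCard : ℝ)) : ℝ) : ℂ) hcard hne hi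
    have h1 := hW'.finite_stable _ htninv hni
    rw [Submodule.mem_comap, map_sub, map_smul] at h1
    have h2 := W'.smul_mem ((((Real.sqrt (v.residueCard : ℝ)) : ℝ) : ℂ) ^ ((n - i) * (n - (n - i))) *
      α.esymm (n - i)) hinv
    have key : rightTranslation (AdelicGroupData.gl n K) ((heckeDiagAt n K v ϖ n)⁻¹ : GL (Fin n) (AdeleRing (𝓞 K) K))
          (heckeOperator (rightTranslation (AdelicGroupData.gl n K)) (principalCongruenceLevel n K 𝔫)
            (heckeDiagAt n K v ϖ (n - i)) φ) -
        ((((Real.sqrt (v.residueCard : ℝ)) : ℝ) : ℂ) ^ ((n - i) * (n - (n - i))) * α.esymm (n - i) *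
          (α.esymm n)⁻¹) • φ =
        (rightTranslation (AdelicGroupData.gl n K) ((heckeDiagAt n K v ϖ n)⁻¹ : GL (Fin n) (AdeleRing (𝓞 K) K))
            (heckeOperator (rightTranslation (AdelicGroupData.gl n K)) (principalCongruenceLevel n K 𝔫)
              (heckeDiagAt n K v ϖ (n - i)) φ) -
          ((((Real.sqrt (v.residueCard : ℝ)) : ℝ) : ℂ) ^ ((n - i) * (n - (n - i))) * α.esymm (n - i)) •
            rightTranslation (AdelicGroupData.gl n K)
              ((heckeDiagAt n K v ϖ n)⁻¹ : GL (Fin n) (AdeleRing (𝓞 K) K)) φ) +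
        ((((Real.sqrt (v.residueCard : ℝ)) : ℝ) : ℂ) ^ ((n - i) * (n - (n - i))) * α.esymm (n - i)) •
          (rightTranslation (AdelicGroupData.gl n K)
              ((heckeDiagAt n K v ϖ n)⁻¹ : GL (Fin n) (AdeleRing (𝓞 K) K)) φ - (α.esymm n)⁻¹ • φ) := by
      rw [smul_sub, smul_smul]
      abel
    rw [hcoef]
    refine (congrArg (· ∈ W') key).mpr ?_
    exact W'.add_mem h1 h2

end Satake

/-! ### The contragredient datum: discharge of `exists_contragredient_satake` -/

section Final

variable {n : ℕ} {K : Type} [Field K] [NumberField K]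

local notation "τ𝔸[" g "]" => weylLong n (AdeleRing (𝓞 K) K) *
  glTransposeInv (Fin n) (AdeleRing (𝓞 K) K) g * weylLong n (AdeleRing (𝓞 K) K)
set_option quotPrecheck false in
local notation "τ𝔸⋆" => LinearMap.funLeft ℂ ℂ (m := (AdelicGroupData.gl n K).Adelic)
  (n := (AdelicGroupData.gl n K).Adelic) fun g => τ𝔸[g]

/-- **The contragredient of a cuspidal automorphic representation of `GL_n(𝔸_K)` and its Satake
parameters** — discharge of the named fact `CuspidalAutomorphicRepData.exists_contragredient_satake`
(`CuspidalContragredient`). For a cuspidal datum `π = W / W'` the datum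
`π' = (W ∘ τ) / (W' ∘ τ)`, `τ(g) = w₀ ᵗg⁻¹ w₀` (the space of forms `g ↦ φ(w₀ ᵗg⁻¹ w₀) = φ̃(w₀ g)`,
`φ ∈ W`; Cogdell 2004, §2, before Thm. 2.1), is again a cuspidal automorphic representation datum
(`IsStableSubmodule`, irreducibility and the cusp conditions are transported along the
automorphism `τ`, the parabolic `P_k` going to `P_{n-k}`), and wherever `π` has Satake parameter
`α`, `π'` has Satake parameter `α⁻¹` (Getz–Hahn 2024, Prop. 7.6.2), at the same level `K(𝔫)`.
[cite: CogdellAnalyticTheory2004, §2 Thm. 2.1 and §1 after Thm. 1.2] -/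
theorem CuspidalAutomorphicRepData.exists_contragredient_satake_holds
    (hcpt : isCompact_glFiniteIntegralLevel n K) :
    CuspidalAutomorphicRepData.exists_contragredient_satake hcpt := by
  intro π
  refine ⟨⟨{ W := π.1.W.map τ𝔸⋆
             W' := π.1.W'.map τ𝔸⋆
             lt := map_funLeft_weylLong_mul_glTransposeInv_mul_weylLong_lt π.1.lt
             stable := π.1.stable.map_funLeft_weylLong_mul_glTransposeInv_mul_weylLong
             stable' := π.1.stable'.map_funLeft_weylLong_mul_glTransposeInv_mul_weylLong
             irreducible :=
               irreducible_map_funLeft_weylLong_mul_glTransposeInv_mul_weylLong π.1.irreducible },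
      (Submodule.map_mono π.2).trans map_funLeft_weylLong_mul_glTransposeInv_mul_weylLong_cuspFormsGL_le⟩,
    fun v α hα => ?_⟩
  exact hasSatakeParamAt_map_funLeft_weylLong_mul_glTransposeInv_mul_weylLong π.1.stable' hα

end Final

end Literature.NumberTheory.Automorphic
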